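import Summits.KontsevichZagierPeriods.KontsevichZagierPeriods.Theorems.ValuedFieldSpecialisationClassLevelExpansionFibreDimOneElementaryB
import Summits.KontsevichZagierPeriods.KontsevichZagierPeriods.Theorems.ValuedFieldSpecialisationClassLevelExpansionFibreDimOneToolkit
import Summits.KontsevichZagierPeriods.KontsevichZagierPeriods.Theorems.ValuedFieldSpecialisationCTConstructionBlowupExists
import Literature.NumberTheory.Transcendental.KZDominatedFamilyRelations
import Literature.NumberTheory.Transcendental.KZProductIdeal

/-!
# Route ValuedFieldSpecialisation — crux `CTConstruction`: degenerate elementary products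

Helper toward crux stmt-KontsevichZagierPeriods-3495 (`CTConstruction`), line `registered`,
reshape r4 (blow-up elimination of the log block), stub `stub_elementary_degenerate`.

An **elementary divergent product** `P = P(p, q, B, d, r)` is an integral representation of
dimension `B + d + 2` in coordinates `z = (s, u, y, w)` (`s = z 0`, `u = z 1`, `y : Fin B → ℝ`,
`w : Fin d → ℝ`) with domain `0 < s < 1`, `0 < u`, `u ^ q * s ^ p < 1`, `s ≤ y_j ≤ 1`,
`w ∈ r.domain` and integrand `∏ y_j⁻¹ · r.integrand w`. For `0 < q ≤ p` such a `P` is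
**degenerate**: the `u`-fibre `(0, s^(-p/q)) ⊇ (0, s⁻¹)` has length `≥ 1/s`, which is not
integrable at `s = 0⁺`, so the absolute integrability of `P.integrand` on `P.domain` forces
`∫_{r.domain} |r.integrand| = 0`, i.e. `r.integrand = 0` a.e. on `r.domain`
(`volume_sep_integrand_ne_zero_eq_zero`; the divergence is witnessed by the disjoint dyadic shells
`2^(-k-2) < s < 2^(-k-1)`, `0 < u < 2^(k+1)`, `1/2 ≤ y_j ≤ 1`, each of which carries mass
`(1/2) · (1/2)^B · ∫ |r|`, `lintegral_enorm_elementaryIntegrand_eq_top`). Consequently `P` splits,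
by domain additivity, into the piece `{P.integrand = 0}` (a fibred relation by integrand
additivity) and the piece `{P.integrand ≠ 0}`, whose domain lies in the cylinder over the null set
`{w ∈ r.domain | r.integrand w ≠ 0}` and is therefore null (a fibred relation by domain
additivity): `stub_elementary_degenerate`, `KZ.of P ∈ KZ.fibredRelations`.

Sources: M. Kontsevich, D. Zagier, *Periods* (2001), §1.2 (rule (1), additivity); J. Bochnak,
M. Coste, M.-F. Roy, *Real Algebraic Geometry* (1998), §2.2 (Prop. 2.2.6, Thm. 2.2.1: the zero set
of a semialgebraic function is semialgebraic). No new definitions.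
-/

noncomputable section

namespace Summit.KontsevichZagierPeriods.ValuedFieldSpecialisation

open MeasureTheory Set Filter
open scoped Topology ENNReal
open Literature.NumberTheory.Transcendental Literature.NumberTheory.Transcendental.KZ
open Literature.ModelTheory.ExponentialFields (IsSemialgebraic)

/-! ### Tonelli for separable `ℝ≥0∞`-valued products in `Fin`-coordinates -/

/-- **Tonelli along `vecCons`** (`ℝ≥0∞` version): `∫⁻ z, f (z 0) · Θ (tail z) = (∫⁻ f) · ∫⁻ Θ` on
`ℝᵐ⁺¹ = ℝ × ℝᵐ` (`(s, x) ↦ vecCons s x` is measure preserving). [folklore] -/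
theorem lintegral_cons_mul {m : ℕ} {f : ℝ → ℝ≥0∞} {Θ : (Fin m → ℝ) → ℝ≥0∞} (hf : AEMeasurable f)
    (hΘ : AEMeasurable Θ) :
    ∫⁻ z : Fin (m + 1) → ℝ, f (z 0) * Θ (fun i => z i.succ) = (∫⁻ s, f s) * ∫⁻ x, Θ x := by
  calc ∫⁻ z : Fin (m + 1) → ℝ, f (z 0) * Θ (fun i => z i.succ)
      = ∫⁻ a : ℝ × (Fin m → ℝ), f a.1 * Θ a.2 ∂((volume : Measure ℝ).prod volume) := by
        rw [← (measurePreserving_vecCons (n := m)).lintegral_comp_emb measurableEmbedding_vecCons]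
        simp only [Matrix.cons_val_zero, Matrix.cons_val_succ]
    _ = (∫⁻ s, f s) * ∫⁻ x, Θ x := lintegral_prod_mul hf hΘ

/-- **Tonelli along `Fin.append`** (`ℝ≥0∞` version): `∫⁻ x, Θ₁ (x|_b) · Θ₂ (x|^d) = (∫⁻ Θ₁) · ∫⁻ Θ₂`
on `ℝᵇ⁺ᵈ = ℝᵇ × ℝᵈ` (`Fin.append` is measure preserving). [folklore] -/
theorem lintegral_append_mul {b d : ℕ} {Θ₁ : (Fin b → ℝ) → ℝ≥0∞} {Θ₂ : (Fin d → ℝ) → ℝ≥0∞}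
    (h₁ : AEMeasurable Θ₁) (h₂ : AEMeasurable Θ₂) :
    ∫⁻ x : Fin (b + d) → ℝ, Θ₁ (fun j => x (Fin.castAdd d j)) * Θ₂ (fun l => x (Fin.natAdd b l)) =
      (∫⁻ y, Θ₁ y) * ∫⁻ w, Θ₂ w := by
  calc ∫⁻ x : Fin (b + d) → ℝ, Θ₁ (fun j => x (Fin.castAdd d j)) * Θ₂ (fun l => x (Fin.natAdd b l))
      = ∫⁻ z : (Fin b → ℝ) × (Fin d → ℝ), Θ₁ z.1 * Θ₂ z.2 := by
        rw [← (volume_preserving_appendMeasurableEquiv (n := b) (m := d)).lintegral_comp_emb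
          (appendMeasurableEquiv b d).measurableEmbedding]
        simp only [appendMeasurableEquiv_apply, Fin.append_left, Fin.append_right]
    _ = (∫⁻ y, Θ₁ y) * ∫⁻ w, Θ₂ w := by
        rw [Measure.volume_eq_prod, lintegral_prod_mul h₁ h₂]

/-! ### Divergence of the elementary products for `q ≤ p` -/

/-- Two dyadic shells `((1/2)^(k+2), (1/2)^(k+1))` that share a point coincide. [folklore] -/
theorem dyadicShell_eq_of_mem {s : ℝ} {k k' : ℕ}
    (hk : s ∈ Ioo ((1 / 2 : ℝ) ^ (k + 2)) ((1 / 2) ^ (k + 1)))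
    (hk' : s ∈ Ioo ((1 / 2 : ℝ) ^ (k' + 2)) ((1 / 2) ^ (k' + 1))) : k = k' := by
  by_contra hne
  rcases Nat.lt_or_gt_of_ne hne with h | h
  · have : (1 / 2 : ℝ) ^ (k' + 1) ≤ (1 / 2) ^ (k + 2) :=
      pow_le_pow_of_le_one (by norm_num) (by norm_num) (by omega)
    linarith [hk.1, hk'.2]
  · have : (1 / 2 : ℝ) ^ (k + 1) ≤ (1 / 2) ^ (k' + 2) :=
      pow_le_pow_of_le_one (by norm_num) (by norm_num) (by omega)
    linarith [hk'.1, hk.2]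

/-- **The elementary products diverge for `0 < q ≤ p` unless `∫ |r| = 0`.** If
`∫⁻_{r.domain} ‖r.integrand‖ₑ ≠ 0` then the `ℝ≥0∞`-integral of `‖∏ y_j⁻¹ · r.integrand w‖ₑ` over the
elementary domain `{0 < s < 1, 0 < u, u^q s^p < 1, s ≤ y_j ≤ 1, w ∈ r.domain}` is `∞`: the domain
contains the disjoint dyadic shells `S_k = {2^(-k-2) < s < 2^(-k-1), 0 < u < 2^(k+1),
1/2 ≤ y_j ≤ 1, w ∈ r.domain}` (`u s < 1` gives `u^q s^p = (u s)^q s^(p-q) < 1`), on which the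
integrand dominates `‖r.integrand w‖ₑ` (`∏ y_j⁻¹ ≥ 1`), and by Tonelli each shell carries the same
mass `(1/2) · (1/2)^B · ∫⁻ ‖r‖ₑ ≠ 0`. [Kontsevich–Zagier 2001, §1.1] [folklore] -/
theorem lintegral_enorm_elementaryIntegrand_eq_top {p q B d : ℕ} (hq : 0 < q) (hqp : q ≤ p)
    (r : IntegralRep d) (hm : ∫⁻ w in r.domain, ‖r.integrand w‖ₑ ≠ 0) :
    ∫⁻ z in {z : Fin (B + d + 1 + 1) → ℝ | 0 < z 0 ∧ z 0 < 1 ∧ 0 < z 1 ∧ z 1 ^ q * z 0 ^ p < 1 ∧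
        (∀ j : Fin B, z 0 ≤ z (Fin.castAdd d j).succ.succ ∧ z (Fin.castAdd d j).succ.succ ≤ 1) ∧
        (fun l : Fin d => z (Fin.natAdd B l).succ.succ) ∈ r.domain},
      ‖(∏ j : Fin B, (z (Fin.castAdd d j).succ.succ)⁻¹) *
        r.integrand (fun l : Fin d => z (Fin.natAdd B l).succ.succ)‖ₑ = ∞ := by
  set D : Set (Fin (B + d + 1 + 1) → ℝ) := {z | 0 < z 0 ∧ z 0 < 1 ∧ 0 < z 1 ∧
    z 1 ^ q * z 0 ^ p < 1 ∧
    (∀ j : Fin B, z 0 ≤ z (Fin.castAdd d j).succ.succ ∧ z (Fin.castAdd d j).succ.succ ≤ 1) ∧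
    (fun l : Fin d => z (Fin.natAdd B l).succ.succ) ∈ r.domain} with hD
  have hDm : MeasurableSet D :=
    IsSemialgebraic.measurableSet_holds (isSemialgebraic_elementaryDomain p q B r)
  -- the `w`-factor `K = 𝟙_{r.domain} ‖r.integrand‖ₑ`
  obtain ⟨K, hK⟩ : ∃ K : (Fin d → ℝ) → ℝ≥0∞,
      ∀ w, K w = r.domain.indicator (fun w => ‖r.integrand w‖ₑ) w := ⟨_, fun _ => rfl⟩
  have hKm : Measurable K := by
    have hfun : K = fun w => ‖r.domain.indicator r.integrand w‖ₑ :=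
      funext fun w => (hK w).trans (enorm_indicator_eq_indicator_enorm _ _).symm
    rw [hfun]
    exact (r.isSemialgebraicFunOn_integrand.measurable_indicator_of_tarskiSeidenberg
      Literature.ModelTheory.ExponentialFields.tarski_seidenberg_real_holds
      (IntegralRep.measurableSet_domain_holds r)).enorm
  have hKi : ∫⁻ w, K w ≠ 0 := by
    rwa [show K = r.domain.indicator (fun w => ‖r.integrand w‖ₑ) from funext hK,
      lintegral_indicator (IntegralRep.measurableSet_domain_holds r)]
  -- the `y`-box `[1/2, 1]^B`
  obtain ⟨box, hbox⟩ : ∃ box : Set (Fin B → ℝ), box = Set.pi univ fun _ => Icc (1 / 2 : ℝ) 1 :=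
    ⟨_, rfl⟩
  have hboxm : MeasurableSet box := hbox ▸ MeasurableSet.univ_pi fun _ => measurableSet_Icc
  have hboxv : volume box ≠ 0 := by
    rw [hbox, volume_pi_pi]
    refine Finset.prod_ne_zero_iff.mpr fun _ _ => ?_
    rw [Real.volume_Icc]
    exact (ENNReal.ofReal_pos.mpr (by norm_num)).ne'
  -- the `(y, w)`-factor
  obtain ⟨H, hH⟩ : ∃ H : (Fin (B + d) → ℝ) → ℝ≥0∞, ∀ x, H x =
      box.indicator 1 (fun j => x (Fin.castAdd d j)) * K (fun l => x (Fin.natAdd B l)) :=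
    ⟨_, fun _ => rfl⟩
  have hHm : Measurable H := by
    rw [show H = _ from funext hH]
    exact ((measurable_one.indicator hboxm).comp
      (measurable_pi_lambda _ fun j => measurable_pi_apply _)).mul
      (hKm.comp (measurable_pi_lambda _ fun l => measurable_pi_apply _))
  have hHi : ∫⁻ x, H x ≠ 0 := by
    simp only [hH]
    rw [lintegral_append_mul (measurable_one.indicator hboxm).aemeasurable hKm.aemeasurable,
      lintegral_indicator_one hboxm]
    exact mul_ne_zero hboxv hKi
  -- the dyadic shells and their indicator products
  obtain ⟨I, hI⟩ : ∃ I : ℕ → Set ℝ, ∀ k, I k = Ioo ((1 / 2 : ℝ) ^ (k + 2)) ((1 / 2) ^ (k + 1)) :=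
    ⟨_, fun _ => rfl⟩
  have hIm : ∀ k, MeasurableSet (I k) := fun k => by rw [hI]; exact measurableSet_Ioo
  obtain ⟨Θ, hΘ⟩ : ∃ Θ : ℕ → (Fin (B + d + 1) → ℝ) → ℝ≥0∞, ∀ k x, Θ k x =
      (Ioo (0 : ℝ) (2 ^ (k + 1))).indicator 1 (x 0) * H (fun i => x i.succ) :=
    ⟨_, fun _ _ => rfl⟩
  have hΘm : ∀ k, Measurable (Θ k) := fun k => by
    rw [show Θ k = _ from funext (hΘ k)]
    exact ((measurable_one.indicator measurableSet_Ioo).comp (measurable_pi_apply 0)).mul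
      (hHm.comp (measurable_pi_lambda _ fun i => measurable_pi_apply _))
  obtain ⟨G, hG⟩ : ∃ G : ℕ → (Fin (B + d + 1 + 1) → ℝ) → ℝ≥0∞, ∀ k z, G k z =
      (I k).indicator 1 (z 0) * Θ k (fun i => z i.succ) := ⟨_, fun _ _ => rfl⟩
  have hGm : ∀ k, Measurable (G k) := fun k => by
    rw [show G k = _ from funext (hG k)]
    exact ((measurable_one.indicator (hIm k)).comp (measurable_pi_apply 0)).mul
      ((hΘm k).comp (measurable_pi_lambda _ fun i => measurable_pi_apply _))
  -- each shell has the same mass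
  have hGi : ∀ k, ∫⁻ z, G k z = ENNReal.ofReal (1 / 2) * ∫⁻ x, H x := fun k => by
    simp only [hG]
    rw [lintegral_cons_mul (measurable_one.indicator (hIm k)).aemeasurable (hΘm k).aemeasurable,
      lintegral_indicator_one (hIm k)]
    simp only [hΘ]
    rw [lintegral_cons_mul (measurable_one.indicator measurableSet_Ioo).aemeasurable
      hHm.aemeasurable, lintegral_indicator_one measurableSet_Ioo, hI, Real.volume_Ioo,
      Real.volume_Ioo, ← mul_assoc, ← ENNReal.ofReal_mul (sub_nonneg.mpr
        (pow_le_pow_of_le_one (by norm_num) (by norm_num) (by omega)))]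
    have h1 : (1 / 2 : ℝ) ^ (k + 1) * 2 ^ (k + 1) = 1 := by rw [← mul_pow]; norm_num
    have hab : ((1 / 2 : ℝ) ^ (k + 1) - (1 / 2) ^ (k + 2)) * (2 ^ (k + 1) - 0) = 1 / 2 := by
      rw [pow_succ (1 / 2 : ℝ) (k + 1)]
      linear_combination (1 / 2 : ℝ) * h1
    rw [hab]
  -- on a shell the integrand dominates `‖r.integrand w‖ₑ`
  have hGle : ∀ k z, G k z ≤
      D.indicator (fun z => ‖(∏ j : Fin B, (z (Fin.castAdd d j).succ.succ)⁻¹) *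
        r.integrand (fun l : Fin d => z (Fin.natAdd B l).succ.succ)‖ₑ) z := by
    intro k z
    by_cases hall : z 0 ∈ I k ∧ z 1 ∈ Ioo (0 : ℝ) (2 ^ (k + 1)) ∧
      (fun j => z (Fin.castAdd d j).succ.succ) ∈ box ∧
      (fun l : Fin d => z (Fin.natAdd B l).succ.succ) ∈ r.domain
    · obtain ⟨h0, h1, hy, hw⟩ := hall
      have h0' : z 0 ∈ Ioo ((1 / 2 : ℝ) ^ (k + 2)) ((1 / 2) ^ (k + 1)) := by rwa [hI] at h0
      have hy' : ∀ j, 1 / 2 ≤ z (Fin.castAdd d j).succ.succ ∧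
          z (Fin.castAdd d j).succ.succ ≤ 1 := by
        rw [hbox] at hy
        simpa only [mem_univ_pi, mem_Icc] using hy
      have hz0 : 0 < z 0 := lt_trans (by positivity) h0'.1
      have hhalf : (1 / 2 : ℝ) ^ (k + 1) ≤ 1 / 2 := by
        calc (1 / 2 : ℝ) ^ (k + 1) ≤ (1 / 2) ^ 1 :=
              pow_le_pow_of_le_one (by norm_num) (by norm_num) (by omega)
          _ = 1 / 2 := pow_one _
      have hz0h : z 0 < 1 / 2 := h0'.2.trans_le hhalf
      have hzD : z ∈ D := by
        rw [hD, mem_setOf_eq]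
        refine ⟨hz0, by linarith, h1.1, ?_, fun j => ⟨by linarith [(hy' j).1], (hy' j).2⟩, hw⟩
        have h01 : z 1 * z 0 < 1 := by
          calc z 1 * z 0 < 2 ^ (k + 1) * (1 / 2) ^ (k + 1) := mul_lt_mul'' h1.2 h0'.2 h1.1.le hz0.le
            _ = 1 := by rw [← mul_pow]; norm_num
        calc z 1 ^ q * z 0 ^ p = (z 1 * z 0) ^ q * z 0 ^ (p - q) := by
              rw [mul_pow, mul_assoc, pow_mul_pow_sub _ hqp]
          _ < 1 := mul_lt_one_of_nonneg_of_lt_one_left (pow_nonneg (mul_nonneg h1.1.le hz0.le) q)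
              (pow_lt_one₀ (mul_nonneg h1.1.le hz0.le) h01 hq.ne')
              (pow_le_one₀ hz0.le (by linarith))
      rw [indicator_of_mem hzD]
      simp only [hG, hΘ, hH, hK, Fin.succ_zero_eq_one, indicator_of_mem h0, indicator_of_mem h1,
        indicator_of_mem hy, indicator_of_mem hw, Pi.one_apply, one_mul]
      rw [enorm_mul]
      refine le_mul_of_one_le_left bot_le ?_
      have hinv : ∀ j, 1 ≤ (z (Fin.castAdd d j).succ.succ)⁻¹ := fun j =>
        (one_le_inv₀ (by linarith [(hy' j).1])).mpr (hy' j).2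
      have hprod : (1 : ℝ) ≤ ∏ j : Fin B, (z (Fin.castAdd d j).succ.succ)⁻¹ := by
        calc (1 : ℝ) = ∏ _j : Fin B, (1 : ℝ) := by simp
          _ ≤ ∏ j : Fin B, (z (Fin.castAdd d j).succ.succ)⁻¹ :=
            Finset.prod_le_prod (fun _ _ => zero_le_one) fun j _ => hinv j
      rw [Real.enorm_eq_ofReal (zero_le_one.trans hprod)]
      exact ENNReal.one_le_ofReal.mpr hprod
    · have hzero : G k z = 0 := by
        simp only [not_and_or] at hall
        rcases hall with h | h | h | h <;>
          simp [hG, hΘ, hH, hK, Fin.succ_zero_eq_one, indicator_of_notMem h]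
      rw [hzero]
      exact bot_le
  -- pointwise: the shells are disjoint, so the sum of the `G k` is still a minorant
  have hpt : ∀ z, ∑' k, G k z ≤
      D.indicator (fun z => ‖(∏ j : Fin B, (z (Fin.castAdd d j).succ.succ)⁻¹) *
        r.integrand (fun l : Fin d => z (Fin.natAdd B l).succ.succ)‖ₑ) z := by
    intro z
    by_cases hex : ∃ k, z 0 ∈ I k
    · obtain ⟨k₀, hk₀⟩ := hex
      rw [tsum_eq_single k₀ fun k hk => ?_]
      · exact hGle k₀ z
      · have hnot : z 0 ∉ I k := fun h =>
          hk (dyadicShell_eq_of_mem (by rwa [hI] at h) (by rwa [hI] at hk₀))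
        simp [hG, indicator_of_notMem hnot]
    · push Not at hex
      have hzero : ∀ k, G k z = 0 := fun k => by simp [hG, indicator_of_notMem (hex k)]
      simp [hzero]
  -- assemble
  rw [← lintegral_indicator hDm]
  refine eq_top_iff.mpr ?_
  calc (⊤ : ℝ≥0∞) = ∑' _ : ℕ, ENNReal.ofReal (1 / 2) * ∫⁻ x, H x :=
        (ENNReal.tsum_const_eq_top_of_ne_zero
          (mul_ne_zero (ENNReal.ofReal_pos.mpr (by norm_num)).ne' hHi)).symm
    _ = ∑' k, ∫⁻ z, G k z := by simp only [hGi]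
    _ = ∫⁻ z, ∑' k, G k z := (lintegral_tsum fun k => (hGm k).aemeasurable).symm
    _ ≤ _ := lintegral_mono hpt

/-- **Degenerate elementary products: the tail integrand vanishes a.e.** If, for `0 < q ≤ p`, the
elementary integrand `∏ y_j⁻¹ · r.integrand w` is absolutely integrable on the elementary domain,
then `r.integrand = 0` almost everywhere on `r.domain`, i.e. `{w ∈ r.domain | r.integrand w ≠ 0}`
is Lebesgue-null (contrapositive of `lintegral_enorm_elementaryIntegrand_eq_top`).
[Kontsevich–Zagier 2001, §1.1] [folklore] -/
theorem volume_sep_integrand_ne_zero_eq_zero {p q B d : ℕ} (hq : 0 < q) (hqp : q ≤ p)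
    (r : IntegralRep d)
    (hint : IntegrableOn (fun z : Fin (B + d + 1 + 1) → ℝ =>
        (∏ j : Fin B, (z (Fin.castAdd d j).succ.succ)⁻¹) *
          r.integrand (fun l : Fin d => z (Fin.natAdd B l).succ.succ))
      {z | 0 < z 0 ∧ z 0 < 1 ∧ 0 < z 1 ∧ z 1 ^ q * z 0 ^ p < 1 ∧
        (∀ j : Fin B, z 0 ≤ z (Fin.castAdd d j).succ.succ ∧ z (Fin.castAdd d j).succ.succ ≤ 1) ∧
        (fun l : Fin d => z (Fin.natAdd B l).succ.succ) ∈ r.domain}) :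
    volume {w | w ∈ r.domain ∧ r.integrand w ≠ 0} = 0 := by
  have hm : ∫⁻ w in r.domain, ‖r.integrand w‖ₑ = 0 := by
    by_contra hm
    exact (hasFiniteIntegral_iff_enorm.mp hint.hasFiniteIntegral).ne
      (lintegral_enorm_elementaryIntegrand_eq_top hq hqp r hm)
  have hae := (setLIntegral_eq_zero_iff' (IntegralRep.measurableSet_domain_holds r)
    r.integrableOn.aemeasurable.enorm).mp hm
  refine measure_mono_null (fun w hw => ?_) (ae_iff.mp hae)
  simp only [mem_setOf_eq, Classical.not_imp, enorm_eq_zero]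
  exact hw

/-! ### The stub -/

/-- **Stub `stub_elementary_degenerate`.** For `0 < q ≤ p`, an integral representation `P`
carrying the data of the elementary divergent product `P(p, q, B, d, r)` is a FIBRED relation:
its integrability forces `r.integrand = 0` a.e. on `r.domain`
(`volume_sep_integrand_ne_zero_eq_zero`), so `P.domain` splits into the `ℚ`-semialgebraic zero set
`E₀ = {z ∈ P.domain | P.integrand z = 0}` of its integrand (Bochnak–Coste–Roy, Thm. 2.2.1) and the
complement `P.domain ∖ E₀`, contained in the cylinder over the null set
`{w ∈ r.domain | r.integrand w ≠ 0}` and hence null; `[P] − [P|E₀]` is a fibred move (domain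
additivity with a null piece) and `[P|E₀]` is a fibred relation (vanishing integrand).
[Kontsevich–Zagier 2001, §1.2, rule (1)] [folklore] -/
theorem stub_elementary_degenerate : ∀ (p q B d : ℕ) (r : Literature.NumberTheory.Transcendental.KZ.IntegralRep d) (P : Literature.NumberTheory.Transcendental.KZ.IntegralRep (B + d + 1 + 1)), 0 < q → q ≤ p → P.domain = {z | ∃ (s u : ℝ) (y : Fin B → ℝ) (w : Fin d → ℝ), z = Matrix.vecCons s (Matrix.vecCons u (Fin.append y w)) ∧ 0 < s ∧ s < 1 ∧ 0 < u ∧ u ^ q * s ^ p < 1 ∧ (∀ j, s ≤ y j ∧ y j ≤ 1) ∧ w ∈ r.domain} → P.integrand = (fun z => (∏ j : Fin B, (z (Fin.castAdd d j).succ.succ)⁻¹) * r.integrand (fun l : Fin d => z (Fin.natAdd B l).succ.succ)) → Literature.NumberTheory.Transcendental.KZ.of P ∈ Literature.NumberTheory.Transcendental.KZ.fibredRelations := by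
  intro p q B d r P hq hqp hPd hPi
  rw [elementaryDomain_eq p q B r] at hPd
  -- the tail integrand vanishes a.e.
  have hint := P.integrableOn
  rw [hPd, hPi] at hint
  have hN := volume_sep_integrand_ne_zero_eq_zero hq hqp r hint
  -- the cylinder over the null set is null
  have hcyl : volume {x : Fin (B + d) → ℝ |
      (fun l => x (Fin.natAdd B l)) ∈ {w | w ∈ r.domain ∧ r.integrand w ≠ 0}} = 0 := by
    have h := volume_cylinder (univ : Set (Fin B → ℝ)) {w | w ∈ r.domain ∧ r.integrand w ≠ 0}
    rw [hN, mul_zero] at h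
    simpa only [mem_univ, true_and] using h
  have hcyl₂ : volume {z : Fin (B + d + 1 + 1) → ℝ |
      (fun l : Fin d => z (Fin.natAdd B l).succ.succ) ∈
        {w | w ∈ r.domain ∧ r.integrand w ≠ 0}} = 0 :=
    volume_setOf_tail_mem_eq_zero (volume_setOf_tail_mem_eq_zero hcyl)
  -- the zero set of the integrand
  have hE₀ : IsSemialgebraic ℚ {z | z ∈ P.domain ∧ P.integrand z = 0} := by
    simpa only [Nat.cast_zero] using isSemialgebraic_sep_eq P.isSemialgebraicFunOn_integrand
      (isSemialgebraicFunOn_natCast P.isSemialgebraic_domain 0)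
  have hE₀sub : {z | z ∈ P.domain ∧ P.integrand z = 0} ⊆ P.domain := fun z hz => hz.1
  have hvol : volume (P.domain \ {z | z ∈ P.domain ∧ P.integrand z = 0}) = 0 := by
    refine measure_mono_null (fun z hz => ?_) hcyl₂
    have hzD := hz.1
    rw [hPd] at hzD
    obtain ⟨-, -, -, -, -, hw⟩ := hzD
    have hne : P.integrand z ≠ 0 := fun h0 => hz.2 ⟨hz.1, h0⟩
    rw [hPi] at hne
    exact ⟨hw, (mul_ne_zero_iff.mp hne).2⟩
  have h1 := of_sub_of_restrict_mem_fibredRelations P hE₀ hE₀sub hvol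
  have h2 : of (P.restrict _ hE₀ hE₀sub) ∈ fibredRelations :=
    of_mem_fibredRelations_of_eqOn_zero _ fun z hz => hz.2
  have := fibredRelations.add_mem h1 h2
  simpa using this

end Summit.KontsevichZagierPeriods.ValuedFieldSpecialisation
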